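import Summits.NavierStokesRegularity.NavierStokesRegularity.Theses.TautLoopKelvin
import Literature.Analysis.FluidPDE.LeraySelfSimilarCalculus
import Literature.Analysis.FluidPDE.VorticityCalculus
import Literature.Analysis.FluidPDE.VectorCalculusProofs
import Literature.Analysis.FluidPDE.NSLerayHopfSereginEnergyProofs

/-!
# Disproof of `TautCompressionIntegrable` — findings

Crux `TautLoopKelvin.TautCompressionIntegrable` (stmt-NavierStokesRegularity-15248), cdisprove seat
`refuter-cdisprove-stmt-NavierStokesRegularity-15248-0`, cycle 1 (2026-08-17). Kernel-checked content
only (rc 0, no `sorry`); prose lives in docstrings.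

* **VERDICT (cycle 1): the crux RESISTS outright refutation.** It is regularity-complete: the rest
  state satisfies hypotheses and conclusion (prior seat, `CruxAttack.lean` §1), all `ℝ`-valued junk
  conventions of the functional (`sSup ∅ = 0`, unbounded `sSup`/`⨅ = 0`, `x/0 = 0`) land on the prover's
  side and none fires for smooth slices (`rate_le_of_norm_fderiv_le`, `bddAbove_tautSet` below), and
  `S → C` modulo the gradient-persistence dictionary (`CruxAttack.lean` §2) makes every counterexample a
  finite-time blow-up from a Schwartz datum. No explicit nonzero classical Leray–Hopf solution on `ℝ³`
  exists in closed form to test.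
* **(a) LOAD-BEARING: the momentum equation.** `TautCompressionIntegrableWithoutMomentum` (the crux
  with `IsClassicalNSSolutionOn ∧ IsLerayHopfOn` replaced by joint smoothness + `div u(t) = 0` + rapid
  decay of EVERY slice) is FALSE: `tautCompressionIntegrable_false_without_momentum` (this file; LANDED as
  `Theorems/TautCompressionIntegrable/Negative/{TautLoopSpaceTools,SwirlStrainProfile,SwirlStrainCalibration,
  FalseWithoutMomentum}.lean`, proposals p159544, p160089, p160358, p160576 accepted; the energy-class part 5
  `FalseWithoutMomentumEnergyClass.lean` = p161007). Witness:
  Leray's backward self-similar zoom `u = λ(t)V_δ(λ(t)x)`, `λ = (1−t)^{-1/2}`, of the explicit smooth,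
  compactly supported, divergence-free profile `V_δ = v_sw + δ·curl(χ_b Ψ₀)` (unit-circle swirl +
  localised Burgers strain). CALIBRATION (`abs_circulation_vW_le`): `∮_γ V_δ = ∮_γ (v_sw + δ m)` with
  `|v_sw + δ m| ≤ 1`, so at level `g = 2π` every admissible loop has length `≥ 2π/λ` while the circle
  `λ⁻¹γ₁` is admissible with exactly that length and compression `δλ²`: `Λ_{2π}(u(s)) ≥ δ/(1−s)`
  (`le_nearTautRate_uW`), not integrable on `(0,1)`. The witness lies in the Leray–Hopf regularity
  class `L^∞L² ∩ L²Ḣ¹` (`lintegral_sq_uW_le`, `lintegral_lintegral_sq_fderiv_uW_lt_top`), so even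
  that membership does not give the crux: `tautCompressionIntegrable_false_without_momentum_energyClass`.
* **(b)/(c) tightness & strengthenings**: only informal (see the `Near-misses` block at the end): the
  law is saturated, not violated, by Lundgren's strained core; the unsteady Burgers–Lundgren vortex is an
  exact classical (infinite-energy, non-decaying) witness against dropping `IsLerayHopfOn ∧
  HasRapidSpatialDecay` while KEEPING the equations — recorded, not formalised.
* **(d) Targets**: none yet (payload `stuck_stubs = []`; line `birth` picked 2026-08-17: stubs 1–2 are
  true/textbook, stubs 3–4 inherit open-problem strength and keep all NS hypotheses — not attackable by
  explicit witnesses for the same reason as the crux).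
* **Reusable tools for provers** (static, junk-robust, over the VERBATIM functional): `len`, `rate`,
  `ell`, `tautSet`, `nearTautRate` (definitionally the crux's expressions at a slice),
  `abs_circulation_le`, `circulation_gradient_eq_zero`, `rate_le_of_norm_fderiv_le`,
  `bddAbove_tautSet`, `rate_le_nearTautRate` (lower bound of `Λ` by ONE taut loop), `ofReal_le_ell`,
  `len_const_smul`.
-/

noncomputable section

namespace Summit.NavierStokesRegularity.NavierStokesRegularity.Cruxes.TautCompressionIntegrable.Disproof

open MeasureTheory Set Filter Metric Real intervalIntegral InnerProductSpace
open scoped ENNReal RealInnerProductSpace ContDiff Topology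
open Literature.Analysis.FluidPDE

set_option linter.dupNamespace false

local notation "ℝ³" => EuclideanSpace ℝ (Fin 3)

/-! ## The loop-space functionals of the crux (verbatim) -/

/-- Length of a loop read on `[0, 1]`. -/
def len (γ : ℝ → ℝ³) : ℝ := ∫ σ in (0:ℝ)..1, ‖deriv γ σ‖

/-- Mean tangential compression rate `k(γ; v)` of the field `v` along `γ` — verbatim the crux's `k`. -/
def rate (v : ℝ³ → ℝ³) (γ : ℝ → ℝ³) : ℝ :=
  (∫ σ in (0:ℝ)..1, -(inner ℝ (deriv γ σ) (fderiv ℝ v (γ σ) (deriv γ σ))) / ‖deriv γ σ‖) /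
    (∫ σ in (0:ℝ)..1, ‖deriv γ σ‖)

/-- The circulation–length spectrum `ℓ(v, g)` (valued in `[0, ∞]`) — verbatim. -/
def ell (v : ℝ³ → ℝ³) (g : ℝ) : ℝ≥0∞ :=
  ⨅ (γ' : ℝ → ℝ³) (_ : IsC1Loop γ' ∧ g ≤ |circulation v γ'|), ENNReal.ofReal (∫ σ in (0:ℝ)..1, ‖deriv γ' σ‖)

/-- The set of compression rates of the `ε`-near-taut admissible loops — verbatim. -/
def tautSet (v : ℝ³ → ℝ³) (g ε : ℝ) : Set ℝ :=
  {k : ℝ | ∃ γ : ℝ → ℝ³, IsC1Loop γ ∧ g ≤ |circulation v γ| ∧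
    ENNReal.ofReal (∫ σ in (0:ℝ)..1, ‖deriv γ σ‖) ≤
      (⨅ (γ' : ℝ → ℝ³) (_ : IsC1Loop γ' ∧ g ≤ |circulation v γ'|),
        ENNReal.ofReal (∫ σ in (0:ℝ)..1, ‖deriv γ' σ‖)) + ENNReal.ofReal ε ∧
    k = ((∫ σ in (0:ℝ)..1, -(inner ℝ (deriv γ σ) (fderiv ℝ v (γ σ) (deriv γ σ))) / ‖deriv γ σ‖) /
      (∫ σ in (0:ℝ)..1, ‖deriv γ σ‖))}

/-- The near-taut compression rate `Λ_g(v)` — verbatim the crux's functional at a slice `v = u s`. -/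
def nearTautRate (v : ℝ³ → ℝ³) (g : ℝ) : ℝ :=
  ⨅ ε : {ε : ℝ // 0 < ε}, sSup (tautSet v g ε)

/-! ## Static loop-space lemmas -/

/-- Lengths are nonnegative. -/
theorem len_nonneg (γ : ℝ → ℝ³) : 0 ≤ len γ :=
  intervalIntegral.integral_nonneg zero_le_one fun _ _ => norm_nonneg _

/-- `|∮_γ v·dl| ≤ sup|v| · length(γ)`. -/
theorem abs_circulation_le {v : ℝ³ → ℝ³} {C : ℝ} (hv : Continuous v) (hC : ∀ x, ‖v x‖ ≤ C)
    {γ : ℝ → ℝ³} (hγ : IsC1Loop γ) : |circulation v γ| ≤ C * len γ := by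
  unfold circulation len
  rw [← intervalIntegral.integral_const_mul]
  refine (intervalIntegral.abs_integral_le_integral_abs zero_le_one).trans ?_
  refine intervalIntegral.integral_mono_on zero_le_one ?_ ?_ (fun σ _ => ?_)
  · exact ((hv.comp hγ.continuous).inner hγ.continuous_deriv).abs.intervalIntegrable 0 1
  · exact (continuous_const.mul hγ.continuous_deriv.norm).intervalIntegrable 0 1
  · exact (abs_real_inner_le_norm _ _).trans (mul_le_mul_of_nonneg_right (hC _) (norm_nonneg _))

/-- Gradient fields have zero circulation around closed `C¹` loops (fundamental theorem of calculus). -/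
theorem circulation_gradient_eq_zero {ψ : ℝ³ → ℝ} (hψ : ContDiff ℝ 1 ψ) {γ : ℝ → ℝ³}
    (hγ : IsC1Loop γ) : circulation (gradient ψ) γ = 0 := by
  unfold circulation
  have hderiv : ∀ s ∈ uIcc (0:ℝ) 1,
      HasDerivAt (fun s => ψ (γ s)) ⟪gradient ψ (γ s), deriv γ s⟫ s := by
    intro s _
    have h1 : HasFDerivAt ψ (fderiv ℝ ψ (γ s)) (γ s) :=
      ((hψ.differentiable one_ne_zero) (γ s)).hasFDerivAt
    have h2 := h1.comp_hasDerivAt s (hγ.differentiable s).hasDerivAt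
    refine h2.congr_deriv ?_
    rw [gradient, InnerProductSpace.toDual_symm_apply]
  have hcont : Continuous (gradient ψ) := by
    show Continuous fun x => (InnerProductSpace.toDual ℝ ℝ³).symm (fderiv ℝ ψ x)
    exact (InnerProductSpace.toDual ℝ ℝ³).symm.continuous.comp (hψ.continuous_fderiv one_ne_zero)
  rw [integral_eq_sub_of_hasDerivAt hderiv
    (((hcont.comp hγ.continuous).inner hγ.continuous_deriv).intervalIntegrable 0 1)]
  rw [hγ.apply_zero_eq_apply_one, sub_self]

/-- **Static bound** `k(γ; v) ≤ L` for every `C¹` loop when `‖Dv‖ ≤ L` pointwise (junk-robust: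
`x / 0 = 0`). -/
theorem rate_le_of_norm_fderiv_le {v : ℝ³ → ℝ³} {L : ℝ} (hL0 : 0 ≤ L)
    (hL : ∀ x, ‖fderiv ℝ v x‖ ≤ L) {γ : ℝ → ℝ³} (hγ : IsC1Loop γ) : rate v γ ≤ L := by
  unfold rate
  have hpt : ∀ σ, ‖-(⟪deriv γ σ, fderiv ℝ v (γ σ) (deriv γ σ)⟫) / ‖deriv γ σ‖‖ ≤ L * ‖deriv γ σ‖ := by
    intro σ
    rw [norm_div, norm_neg, norm_norm, Real.norm_eq_abs]
    by_cases h0 : deriv γ σ = 0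
    · simp [h0]
    · rw [div_le_iff₀ (norm_pos_iff.2 h0)]
      calc |⟪deriv γ σ, fderiv ℝ v (γ σ) (deriv γ σ)⟫|
          ≤ ‖deriv γ σ‖ * ‖fderiv ℝ v (γ σ) (deriv γ σ)‖ := abs_real_inner_le_norm _ _
        _ ≤ ‖deriv γ σ‖ * (L * ‖deriv γ σ‖) := by
            gcongr
            exact (ContinuousLinearMap.le_opNorm _ _).trans
              (mul_le_mul_of_nonneg_right (hL _) (norm_nonneg _))
        _ = L * ‖deriv γ σ‖ * ‖deriv γ σ‖ := by ring
  have hnum : ‖∫ σ in (0:ℝ)..1, -(⟪deriv γ σ, fderiv ℝ v (γ σ) (deriv γ σ)⟫) / ‖deriv γ σ‖‖ ≤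
      ∫ σ in (0:ℝ)..1, L * ‖deriv γ σ‖ :=
    intervalIntegral.norm_integral_le_of_norm_le zero_le_one (ae_of_all _ fun σ _ => hpt σ)
      ((continuous_const.mul hγ.continuous_deriv.norm).intervalIntegrable 0 1)
  rw [intervalIntegral.integral_const_mul] at hnum
  rcases (len_nonneg γ).eq_or_lt with h0 | hpos
  · unfold len at h0
    rw [← h0, div_zero]
    exact hL0
  · unfold len at hpos
    rw [div_le_iff₀ hpos]
    exact (Real.le_norm_self _).trans hnum

/-- The near-taut rate sets are bounded above by any pointwise bound of `‖Dv‖`. -/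
theorem bddAbove_tautSet {v : ℝ³ → ℝ³} {L : ℝ} (hL0 : 0 ≤ L) (hL : ∀ x, ‖fderiv ℝ v x‖ ≤ L)
    (g ε : ℝ) : BddAbove (tautSet v g ε) := by
  refine ⟨L, fun k hk => ?_⟩
  obtain ⟨γ, hγ, -, -, hk⟩ := hk
  rw [hk]
  exact rate_le_of_norm_fderiv_le hL0 hL hγ

/-- **Lower bound for `Λ_g(v)` by one taut loop**: if the rate sets are bounded above and `γ₀` is an
admissible loop of minimal length (`ofReal (len γ₀) ≤ ℓ`), then `k(γ₀; v) ≤ Λ_g(v)`. -/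
theorem rate_le_nearTautRate {v : ℝ³ → ℝ³} {g : ℝ} {γ₀ : ℝ → ℝ³}
    (hbdd : ∀ ε : ℝ, 0 < ε → BddAbove (tautSet v g ε))
    (h₀ : IsC1Loop γ₀) (hadm : g ≤ |circulation v γ₀|)
    (htaut : ENNReal.ofReal (len γ₀) ≤ ell v g) :
    rate v γ₀ ≤ nearTautRate v g := by
  unfold nearTautRate
  haveI : Nonempty {ε : ℝ // 0 < ε} := ⟨⟨1, one_pos⟩⟩
  refine le_ciInf fun ε => ?_
  refine le_csSup (hbdd ε.1 ε.2) ⟨γ₀, h₀, hadm, ?_, rfl⟩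
  exact htaut.trans le_self_add

/-- A uniform lower bound on the lengths of admissible loops bounds `ℓ` from below. -/
theorem ofReal_le_ell {v : ℝ³ → ℝ³} {g c : ℝ}
    (h : ∀ γ : ℝ → ℝ³, IsC1Loop γ → g ≤ |circulation v γ| → c ≤ len γ) :
    ENNReal.ofReal c ≤ ell v g :=
  le_iInf₂ fun γ hγ => ENNReal.ofReal_le_ofReal (h γ hγ.1 hγ.2)

/-- Length of a dilated loop. -/
theorem len_const_smul {γ : ℝ → ℝ³} (hγ : IsC1Loop γ) {c : ℝ} (hc : 0 ≤ c) :
    len (fun σ => c • γ σ) = c * len γ := by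
  unfold len
  rw [← intervalIntegral.integral_const_mul]
  refine intervalIntegral.integral_congr fun σ _ => ?_
  show ‖deriv (c • γ) σ‖ = c * ‖deriv γ σ‖
  rw [deriv_const_smul c (hγ.differentiable σ), norm_smul, Real.norm_eq_abs, abs_of_nonneg hc]

/-! ## Linear algebra on `ℝ³`: the frame, the rotation generator, the strain -/

/-- `e₀ = (1, 0, 0)`. -/
def e0 : ℝ³ := EuclideanSpace.single 0 1

/-- `e₁ = (0, 1, 0)`. -/
def e1 : ℝ³ := EuclideanSpace.single 1 1

/-- `e₂ = (0, 0, 1)`. -/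
def e2 : ℝ³ := EuclideanSpace.single 2 1

/-- The rotation generator `J x = e₂ × x = (−x₁, x₀, 0)`. -/
def Jrot : ℝ³ →L[ℝ] ℝ³ :=
  (EuclideanSpace.proj (0 : Fin 3) : ℝ³ →L[ℝ] ℝ).smulRight e1 -
    (EuclideanSpace.proj (1 : Fin 3) : ℝ³ →L[ℝ] ℝ).smulRight e0

/-- The axisymmetric (Burgers) strain `S x = (−x₀, −x₁, 2x₂)`: symmetric, trace free, contracting the
horizontal plane at unit rate. -/
def Sst : ℝ³ →L[ℝ] ℝ³ :=
  -ContinuousLinearMap.id ℝ ℝ³ + (3 : ℝ) • (EuclideanSpace.proj (2 : Fin 3) : ℝ³ →L[ℝ] ℝ).smulRight e2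

/-- Coordinates of `J x = (−x₁, x₀, 0)`. -/
@[simp] theorem Jrot_apply_zero (x : ℝ³) : Jrot x 0 = -x 1 := by
  simp [Jrot, e0, e1]

/-- Coordinates of `J x = (−x₁, x₀, 0)`. -/
@[simp] theorem Jrot_apply_one (x : ℝ³) : Jrot x 1 = x 0 := by
  simp [Jrot, e0, e1]

/-- Coordinates of `J x = (−x₁, x₀, 0)`. -/
@[simp] theorem Jrot_apply_two (x : ℝ³) : Jrot x 2 = 0 := by
  simp [Jrot, e0, e1]

/-- Coordinates of `S x = (−x₀, −x₁, 2x₂)`. -/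
@[simp] theorem Sst_apply_zero (x : ℝ³) : Sst x 0 = -x 0 := by
  simp [Sst, e2]

/-- Coordinates of `S x = (−x₀, −x₁, 2x₂)`. -/
@[simp] theorem Sst_apply_one (x : ℝ³) : Sst x 1 = -x 1 := by
  simp [Sst, e2]

/-- Coordinates of `S x = (−x₀, −x₁, 2x₂)`. -/
@[simp] theorem Sst_apply_two (x : ℝ³) : Sst x 2 = 2 * x 2 := by
  simp [Sst, e2]
  ring

/-- `⟪y, J y⟫ = 0`. -/
theorem inner_Jrot_self (y : ℝ³) : ⟪y, Jrot y⟫ = 0 := by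
  simp only [PiLp.inner_apply, Fin.sum_univ_three, RCLike.inner_apply, conj_trivial,
    Jrot_apply_zero, Jrot_apply_one, Jrot_apply_two]
  ring

/-- `‖J x‖² = x₀² + x₁²`. -/
theorem norm_Jrot_sq (x : ℝ³) : ‖Jrot x‖ ^ 2 = x 0 ^ 2 + x 1 ^ 2 := by
  rw [EuclideanSpace.norm_sq_eq]
  simp only [Fin.sum_univ_three, Real.norm_eq_abs, sq_abs, Jrot_apply_zero, Jrot_apply_one,
    Jrot_apply_two]
  ring

/-- `‖x‖² = x₀² + x₁² + x₂²`. -/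
theorem norm_sq_eq_three (x : ℝ³) : ‖x‖ ^ 2 = x 0 ^ 2 + x 1 ^ 2 + x 2 ^ 2 := by
  rw [EuclideanSpace.norm_sq_eq]
  simp only [Fin.sum_univ_three, Real.norm_eq_abs, sq_abs]

/-! ## The unit circle `γ₁` in the horizontal plane -/

/-- The unit circle in the plane of `(e₀, e₁)` about the origin, parametrised `1`-periodically. -/
def γ₁ : ℝ → ℝ³ := circleLoop 0 1 e0 e1

/-- The unit circle is a closed `C¹` loop. -/
theorem isC1Loop_γ₁ : IsC1Loop γ₁ := isC1Loop_circleLoop 0 1 e0 e1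

/-- The unit circle in the frame `(e₀, e₁)`. -/
theorem γ₁_apply (s : ℝ) : γ₁ s = (cos (2 * π * s)) • e0 + (sin (2 * π * s)) • e1 := by
  simp [γ₁, circleLoop]

/-- Coordinates of the unit circle. -/
@[simp] theorem γ₁_apply_zero (s : ℝ) : γ₁ s 0 = cos (2 * π * s) := by
  simp [γ₁_apply, e0, e1]

/-- Coordinates of the unit circle. -/
@[simp] theorem γ₁_apply_one (s : ℝ) : γ₁ s 1 = sin (2 * π * s) := by
  simp [γ₁_apply, e0, e1]

/-- Coordinates of the unit circle (it is horizontal). -/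
@[simp] theorem γ₁_apply_two (s : ℝ) : γ₁ s 2 = 0 := by
  simp [γ₁_apply, e0, e1]

/-- `γ₁' = 2π J γ₁`. -/
theorem deriv_γ₁ (s : ℝ) : deriv γ₁ s = (2 * π) • Jrot (γ₁ s) := by
  rw [γ₁, deriv_circleLoop]
  congr 1
  ext i
  fin_cases i <;> simp [e0, e1, circleLoop]

/-- Velocity of the unit circle. -/
theorem hasDerivAt_γ₁ (s : ℝ) : HasDerivAt γ₁ ((2 * π) • Jrot (γ₁ s)) s := by
  rw [← deriv_γ₁]
  exact (isC1Loop_γ₁.differentiable s).hasDerivAt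

/-- `‖J γ₁(s)‖ = 1`. -/
theorem norm_Jrot_γ₁ (s : ℝ) : ‖Jrot (γ₁ s)‖ = 1 := by
  have h : ‖Jrot (γ₁ s)‖ ^ 2 = 1 := by
    rw [norm_Jrot_sq, γ₁_apply_zero, γ₁_apply_one, cos_sq_add_sin_sq]
  have h0 : 0 ≤ ‖Jrot (γ₁ s)‖ := norm_nonneg _
  nlinarith [h, h0]

/-- `‖γ₁'‖ = 2π`. -/
theorem norm_deriv_γ₁ (s : ℝ) : ‖deriv γ₁ s‖ = 2 * π := by
  rw [deriv_γ₁, norm_smul, norm_Jrot_γ₁, mul_one, Real.norm_eq_abs, abs_of_pos two_pi_pos]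

/-- `‖γ₁(s)‖ = 1`. -/
theorem norm_γ₁ (s : ℝ) : ‖γ₁ s‖ = 1 := by
  have h : ‖γ₁ s‖ ^ 2 = 1 := by
    rw [norm_sq_eq_three, γ₁_apply_zero, γ₁_apply_one, γ₁_apply_two, cos_sq_add_sin_sq]
    ring
  have h0 : 0 ≤ ‖γ₁ s‖ := norm_nonneg _
  nlinarith [h, h0]

/-- The length of the unit circle is `2π`. -/
theorem len_γ₁ : len γ₁ = 2 * π := by
  unfold len
  simp_rw [norm_deriv_γ₁]
  simp

/-- The strain acts as `−id` on horizontal vectors: `S γ₁' = −γ₁'`. -/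
theorem Sst_deriv_γ₁ (s : ℝ) : Sst (deriv γ₁ s) = -deriv γ₁ s := by
  ext i
  fin_cases i <;> simp [deriv_γ₁]

/-- `J x = −x₁ e₀ + x₀ e₁`. -/
theorem Jrot_eq (x : ℝ³) : Jrot x = (-x 1) • e0 + (x 0) • e1 := by
  ext i
  fin_cases i <;> simp [e0, e1]

/-! ## The profile: a unit-circle swirl plus a localised Burgers strain -/

/-- Cut-off of the radial profile about `ρ² = 1`: `1` on `[1/2, 3/2]`, `0` off `(1/4, 7/4)`. -/
def χ1 : ContDiffBump (1 : ℝ) := ⟨1 / 2, 3 / 4, by norm_num, by norm_num⟩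

/-- Vertical cut-off: `1` on `[-1, 1]`, `0` off `(-2, 2)`. -/
def β0 : ContDiffBump (0 : ℝ) := ⟨1, 2, one_pos, one_lt_two⟩

/-- Localiser of the strain: `1` on `B̄(0, 4)`, `0` off `B(0, 5)`. -/
def χb : ContDiffBump (0 : ℝ³) := ⟨4, 5, by norm_num, by norm_num⟩

/-- `ρ² = x₀² + x₁²`. -/
def ρ2 (x : ℝ³) : ℝ := x 0 * x 0 + x 1 * x 1

/-- The swirl amplitude as a function of `(ρ², x₂)`: `e^{(1 − ρ²)/2} χ₁(ρ²) β₀(x₂)`. -/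
def Fprof (p : ℝ × ℝ) : ℝ := Real.exp ((1 - p.1) / 2) * χ1 p.1 * β0 p.2

/-- `x ↦ (ρ², x₂)`. -/
def qmap (x : ℝ³) : ℝ × ℝ := (ρ2 x, x 2)

/-- The swirl amplitude `f(x) = e^{(1 − ρ²)/2} χ₁(ρ²) β₀(x₂)` (axisymmetric about the `x₂`-axis). -/
def famp (x : ℝ³) : ℝ := Fprof (qmap x)

/-- **The swirl** `v_sw(x) = f(x) J x`: smooth, compactly supported, divergence free, `|v_sw| ≤ 1`
with equality exactly tangentially along the unit circle `γ₁`. -/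
def vSwirl (x : ℝ³) : ℝ³ := famp x • Jrot x

/-- The strain potential `φ = ½(−x₀² − x₁² + 2x₂²)` (harmonic), `∇φ = S x`. -/
def φpot (x : ℝ³) : ℝ := x 2 * x 2 - (x 0 * x 0 + x 1 * x 1) * 2⁻¹

/-- The vector potential `Ψ₀ = (−x₁x₂, x₀x₂, 0)` of the strain: `curl Ψ₀ = S x`. -/
def Ψ0 (x : ℝ³) : ℝ³ := (-(x 1 * x 2)) • e0 + (x 0 * x 2) • e1

/-- The potential localised by `χ_b`. -/
def Ψloc (x : ℝ³) : ℝ³ := χb x • Ψ0 x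

/-- **The localised Burgers strain** `w = curl (χ_b Ψ₀)`: smooth, compactly supported, divergence
free, and equal to the linear strain `S x = (−x₀, −x₁, 2x₂)` on the ball `‖x‖ < 4`. -/
def wStr : ℝ³ → ℝ³ := curl Ψloc

/-- The localised scalar potential `ψ = χ_b φ`. -/
def ψpot (x : ℝ³) : ℝ := χb x * φpot x

/-- The residual `m = w − ∇ψ`, supported in the shell `4 ≤ ‖x‖ ≤ 5` (away from the swirl). -/
def mRes (x : ℝ³) : ℝ³ := wStr x - gradient ψpot x

/-- **The profile** `V_δ = v_sw + δ w`. -/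
def vW (δ : ℝ) : ℝ³ → ℝ³ := vSwirl + δ • wStr

/-! ### Smoothness -/

/-- Coordinates are smooth. -/
theorem contDiff_coord (i : Fin 3) : ContDiff ℝ ∞ fun x : ℝ³ => x i :=
  contDiff_piLp_apply (p := 2) (i := i)

/-- `ρ²` is smooth. -/
theorem contDiff_ρ2 : ContDiff ℝ ∞ ρ2 :=
  ((contDiff_coord 0).mul (contDiff_coord 0)).add ((contDiff_coord 1).mul (contDiff_coord 1))

/-- The amplitude profile is smooth. -/
theorem contDiff_Fprof : ContDiff ℝ ∞ Fprof :=
  ((Real.contDiff_exp.comp ((contDiff_const.sub contDiff_fst).div_const 2)).mul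
    (χ1.contDiff.comp contDiff_fst)).mul (β0.contDiff.comp contDiff_snd)

/-- `x ↦ (ρ², x₂)` is smooth. -/
theorem contDiff_qmap : ContDiff ℝ ∞ qmap := contDiff_ρ2.prodMk (contDiff_coord 2)

/-- The swirl amplitude is smooth. -/
theorem contDiff_famp : ContDiff ℝ ∞ famp := contDiff_Fprof.comp contDiff_qmap

/-- The swirl is smooth. -/
theorem contDiff_vSwirl : ContDiff ℝ ∞ vSwirl := contDiff_famp.smul Jrot.contDiff

/-- The strain potential is smooth. -/
theorem contDiff_φpot : ContDiff ℝ ∞ φpot :=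
  ((contDiff_coord 2).mul (contDiff_coord 2)).sub
    ((((contDiff_coord 0).mul (contDiff_coord 0)).add ((contDiff_coord 1).mul (contDiff_coord 1))).mul
      contDiff_const)

/-- The vector potential is smooth. -/
theorem contDiff_Ψ0 : ContDiff ℝ ∞ Ψ0 :=
  (((contDiff_coord 1).mul (contDiff_coord 2)).neg.smul contDiff_const).add
    (((contDiff_coord 0).mul (contDiff_coord 2)).smul contDiff_const)

/-- The localised vector potential is smooth. -/
theorem contDiff_Ψloc : ContDiff ℝ ∞ Ψloc := χb.contDiff.smul contDiff_Ψ0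

/-- The localised strain is smooth. -/
theorem contDiff_wStr : ContDiff ℝ ∞ wStr :=
  contDiff_curl (n := ⊤) (contDiff_Ψloc.of_le (by exact_mod_cast le_top))

/-- The localised scalar potential is smooth. -/
theorem contDiff_ψpot : ContDiff ℝ ∞ ψpot := χb.contDiff.mul contDiff_φpot

/-- The profile is smooth. -/
theorem contDiff_vW (δ : ℝ) : ContDiff ℝ ∞ (vW δ) :=
  contDiff_vSwirl.add (contDiff_const.smul contDiff_wStr)

/-! ### The swirl is divergence free (its amplitude is constant along the rotation field) -/

/-- `Df(x)[J x] = 0`: `f` factors through `(ρ², x₂)`, and `J x` is tangent to their level sets. -/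
theorem fderiv_famp_Jrot (x : ℝ³) : fderiv ℝ famp x (Jrot x) = 0 := by
  have h0 : HasFDerivAt (fun y : ℝ³ => y 0) (EuclideanSpace.proj 0 : ℝ³ →L[ℝ] ℝ) x :=
    PiLp.hasFDerivAt_apply 2 x 0
  have h1 : HasFDerivAt (fun y : ℝ³ => y 1) (EuclideanSpace.proj 1 : ℝ³ →L[ℝ] ℝ) x :=
    PiLp.hasFDerivAt_apply 2 x 1
  have h2 : HasFDerivAt (fun y : ℝ³ => y 2) (EuclideanSpace.proj 2 : ℝ³ →L[ℝ] ℝ) x :=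
    PiLp.hasFDerivAt_apply 2 x 2
  have hq : HasFDerivAt qmap
      (((x 0 • (EuclideanSpace.proj 0 : ℝ³ →L[ℝ] ℝ) + x 0 • (EuclideanSpace.proj 0 : ℝ³ →L[ℝ] ℝ)) +
        (x 1 • (EuclideanSpace.proj 1 : ℝ³ →L[ℝ] ℝ) + x 1 • (EuclideanSpace.proj 1 : ℝ³ →L[ℝ] ℝ))).prod
        (EuclideanSpace.proj 2 : ℝ³ →L[ℝ] ℝ)) x :=
    ((h0.mul h0).add (h1.mul h1)).prodMk h2
  have hF : DifferentiableAt ℝ Fprof (qmap x) := (contDiff_Fprof.differentiable (by simp)) _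
  show fderiv ℝ (Fprof ∘ qmap) x (Jrot x) = 0
  rw [fderiv_comp x hF hq.differentiableAt, hq.fderiv]
  simp only [ContinuousLinearMap.coe_comp, Function.comp_apply]
  have hzero : (((x 0 • (EuclideanSpace.proj 0 : ℝ³ →L[ℝ] ℝ) + x 0 • (EuclideanSpace.proj 0 : ℝ³ →L[ℝ] ℝ)) +
        (x 1 • (EuclideanSpace.proj 1 : ℝ³ →L[ℝ] ℝ) + x 1 • (EuclideanSpace.proj 1 : ℝ³ →L[ℝ] ℝ))).prod
        (EuclideanSpace.proj 2 : ℝ³ →L[ℝ] ℝ)) (Jrot x) = 0 := by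
    rw [ContinuousLinearMap.prod_apply, Prod.mk_eq_zero]
    constructor
    · simp only [add_apply, FunLike.coe_smul, Pi.smul_apply,
        smul_eq_mul, PiLp.proj_apply, Jrot_apply_zero, Jrot_apply_one]
      ring
    · simp [PiLp.proj_apply]
  rw [hzero, map_zero]

/-- **`div v_sw = 0`.** -/
theorem divergence_vSwirl (x : ℝ³) : VectorCalculus.divergence vSwirl x = 0 := by
  have hf : DifferentiableAt ℝ famp x := (contDiff_famp.differentiable (by simp)) x
  have hD : fderiv ℝ vSwirl x = famp x • Jrot + (fderiv ℝ famp x).smulRight (Jrot x) := by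
    show fderiv ℝ (fun y => famp y • Jrot y) x = _
    rw [fderiv_fun_smul hf Jrot.differentiableAt, ContinuousLinearMap.fderiv]
  rw [divergence_eq_sum_inner_fderiv (EuclideanSpace.basisFun (Fin 3) ℝ), hD]
  have key : fderiv ℝ famp x (Jrot x) = 0 := fderiv_famp_Jrot x
  rw [Jrot_eq x, map_add, map_smul, map_smul] at key
  simp only [Fin.sum_univ_three, EuclideanSpace.basisFun_apply, add_apply,
    FunLike.coe_smul, Pi.smul_apply, ContinuousLinearMap.smulRight_apply,
    inner_add_right, EuclideanSpace.inner_single_left, map_one, one_mul]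
  simp only [smul_eq_mul, e0, e1] at key
  simp
  linarith [key]

/-- The swirl is divergence free. -/
theorem isDivFree_vSwirl : VectorCalculus.IsDivFree vSwirl := divergence_vSwirl

/-- `div w = div curl (χ_b Ψ₀) = 0`. -/
theorem isDivFree_wStr : VectorCalculus.IsDivFree wStr := fun x =>
  divergence_curl_eq_zero_holds Ψloc (contDiff_infty.1 contDiff_Ψloc 2) x

/-- **`div V_δ = 0`.** -/
theorem isDivFree_vW (δ : ℝ) : VectorCalculus.IsDivFree (vW δ) := by
  intro x
  have h1 : DifferentiableAt ℝ vSwirl x := (contDiff_vSwirl.differentiable (by simp)) x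
  have h2 : DifferentiableAt ℝ wStr x := (contDiff_wStr.differentiable (by simp)) x
  unfold VectorCalculus.divergence
  rw [vW, fderiv_add h1 (h2.const_smul δ), fderiv_const_smul h2]
  have e1' := isDivFree_vSwirl x
  have e2' := isDivFree_wStr x
  unfold VectorCalculus.divergence at e1' e2'
  simp [e1', e2']

/-! ### The strain: `curl Ψ₀ = ∇φ = S` and the localisation -/

/-- `curl Ψ₀ = S`. -/
theorem curl_Ψ0 (x : ℝ³) : curl Ψ0 x = Sst x := by
  have h0 : HasFDerivAt (fun y : ℝ³ => y 0) (EuclideanSpace.proj 0 : ℝ³ →L[ℝ] ℝ) x :=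
    PiLp.hasFDerivAt_apply 2 x 0
  have h1 : HasFDerivAt (fun y : ℝ³ => y 1) (EuclideanSpace.proj 1 : ℝ³ →L[ℝ] ℝ) x :=
    PiLp.hasFDerivAt_apply 2 x 1
  have h2 : HasFDerivAt (fun y : ℝ³ => y 2) (EuclideanSpace.proj 2 : ℝ³ →L[ℝ] ℝ) x :=
    PiLp.hasFDerivAt_apply 2 x 2
  have hΨ : HasFDerivAt Ψ0
      ((-(x 1 • (EuclideanSpace.proj 2 : ℝ³ →L[ℝ] ℝ) + x 2 • (EuclideanSpace.proj 1 : ℝ³ →L[ℝ] ℝ))).smulRight e0 +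
        (x 0 • (EuclideanSpace.proj 2 : ℝ³ →L[ℝ] ℝ) + x 2 • (EuclideanSpace.proj 0 : ℝ³ →L[ℝ] ℝ)).smulRight e1) x :=
    ((h1.mul h2).neg.smul_const e0).add ((h0.mul h2).smul_const e1)
  rw [curl, hΨ.fderiv]
  ext i
  fin_cases i <;> simp [e0, e1, PiLp.proj_apply]
  ring

/-- `∇φ = S`. -/
theorem hasFDerivAt_φpot (x : ℝ³) :
    HasFDerivAt φpot (InnerProductSpace.toDual ℝ ℝ³ (Sst x)) x := by
  have h0 : HasFDerivAt (fun y : ℝ³ => y 0) (EuclideanSpace.proj 0 : ℝ³ →L[ℝ] ℝ) x :=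
    PiLp.hasFDerivAt_apply 2 x 0
  have h1 : HasFDerivAt (fun y : ℝ³ => y 1) (EuclideanSpace.proj 1 : ℝ³ →L[ℝ] ℝ) x :=
    PiLp.hasFDerivAt_apply 2 x 1
  have h2 : HasFDerivAt (fun y : ℝ³ => y 2) (EuclideanSpace.proj 2 : ℝ³ →L[ℝ] ℝ) x :=
    PiLp.hasFDerivAt_apply 2 x 2
  have h : HasFDerivAt φpot
      ((x 2 • (EuclideanSpace.proj 2 : ℝ³ →L[ℝ] ℝ) + x 2 • (EuclideanSpace.proj 2 : ℝ³ →L[ℝ] ℝ)) -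
        (2⁻¹ : ℝ) • ((x 0 • (EuclideanSpace.proj 0 : ℝ³ →L[ℝ] ℝ) + x 0 • (EuclideanSpace.proj 0 : ℝ³ →L[ℝ] ℝ)) +
          (x 1 • (EuclideanSpace.proj 1 : ℝ³ →L[ℝ] ℝ) + x 1 • (EuclideanSpace.proj 1 : ℝ³ →L[ℝ] ℝ)))) x :=
    (h2.mul h2).sub (((h0.mul h0).add (h1.mul h1)).mul_const (2⁻¹ : ℝ))
  refine h.congr_fderiv (ContinuousLinearMap.ext fun y => ?_)
  simp only [InnerProductSpace.toDual_apply_apply, PiLp.inner_apply, Fin.sum_univ_three,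
    RCLike.inner_apply, conj_trivial, Sst_apply_zero, Sst_apply_one, Sst_apply_two,
    add_apply, sub_apply, FunLike.coe_smul, Pi.smul_apply, smul_eq_mul, PiLp.proj_apply]
  ring

/-- `∇φ = S`. -/
theorem gradient_φpot (x : ℝ³) : gradient φpot x = Sst x :=
  (hasGradientAt_iff_hasFDerivAt.mpr (hasFDerivAt_φpot x)).gradient

/-- `χ_b = 1` on the closed ball of radius `4`. -/
theorem χb_eq_one {x : ℝ³} (hx : ‖x‖ ≤ 4) : χb x = 1 :=
  χb.one_of_mem_closedBall (by simpa [χb] using hx)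

/-- On the ball `‖x‖ < 4` the localised strain is the linear strain: `w = S`. -/
theorem wStr_eq_Sst {x : ℝ³} (hx : ‖x‖ < 4) : wStr x = Sst x := by
  have hev : Ψloc =ᶠ[𝓝 x] Ψ0 := by
    filter_upwards [isOpen_ball.mem_nhds (mem_ball_zero_iff.2 hx)] with y hy
    rw [Ψloc, χb_eq_one (le_of_lt (mem_ball_zero_iff.1 hy)), one_smul]
  rw [wStr, curl_eq_curlCLM, hev.fderiv_eq, ← curl_eq_curlCLM, curl_Ψ0]

/-- Near a point of the ball `‖x‖ < 4` the localised strain agrees with `S`. -/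
theorem wStr_eventuallyEq {x : ℝ³} (hx : ‖x‖ < 4) : wStr =ᶠ[𝓝 x] (⇑Sst) := by
  filter_upwards [isOpen_ball.mem_nhds (mem_ball_zero_iff.2 hx)] with y hy
  exact wStr_eq_Sst (mem_ball_zero_iff.1 hy)

/-- On the ball `‖x‖ < 4`: `Dw = S`. -/
theorem fderiv_wStr {x : ℝ³} (hx : ‖x‖ < 4) : fderiv ℝ wStr x = Sst := by
  rw [(wStr_eventuallyEq hx).fderiv_eq, ContinuousLinearMap.fderiv]

/-- On the ball `‖x‖ < 4`: `∇ψ = ∇φ = S`. -/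
theorem gradient_ψpot {x : ℝ³} (hx : ‖x‖ < 4) : gradient ψpot x = Sst x := by
  have hev : ψpot =ᶠ[𝓝 x] φpot := by
    filter_upwards [isOpen_ball.mem_nhds (mem_ball_zero_iff.2 hx)] with y hy
    rw [ψpot, χb_eq_one (le_of_lt (mem_ball_zero_iff.1 hy)), one_mul]
  unfold gradient
  rw [hev.fderiv_eq]
  exact gradient_φpot x

/-- The residual vanishes on the ball `‖x‖ < 4` (in particular near the swirl). -/
theorem mRes_eq_zero {x : ℝ³} (hx : ‖x‖ < 4) : mRes x = 0 := by
  rw [mRes, wStr_eq_Sst hx, gradient_ψpot hx, sub_self]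

/-! ### Support and size of the swirl -/

/-- The swirl amplitude is nonnegative. -/
theorem famp_nonneg (x : ℝ³) : 0 ≤ famp x :=
  mul_nonneg (mul_nonneg (Real.exp_pos _).le (χ1.nonneg)) (β0.nonneg)

/-- The swirl amplitude is at most `e^{(1 − ρ²)/2}`. -/
theorem famp_le (x : ℝ³) : famp x ≤ Real.exp ((1 - ρ2 x) / 2) := by
  unfold famp Fprof qmap
  have h1 : χ1 (ρ2 x) ≤ 1 := χ1.le_one
  have h2 : β0 (x 2) ≤ 1 := β0.le_one
  have h3 : 0 ≤ χ1 (ρ2 x) := χ1.nonneg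
  have h4 : 0 ≤ β0 (x 2) := β0.nonneg
  have h5 : 0 < Real.exp ((1 - ρ2 x) / 2) := Real.exp_pos _
  calc Real.exp ((1 - ρ2 x) / 2) * χ1 (ρ2 x) * β0 (x 2)
      ≤ Real.exp ((1 - ρ2 x) / 2) * 1 * 1 := by gcongr
    _ = Real.exp ((1 - ρ2 x) / 2) := by ring

/-- The key scalar inequality `e^{(1−t)/2} √t ≤ 1` (`t ≤ e^{t−1}`). -/
theorem exp_mul_sqrt_le_one (t : ℝ) : Real.exp ((1 - t) / 2) * Real.sqrt t ≤ 1 := by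
  have h1 : Real.sqrt t ≤ Real.exp ((t - 1) / 2) := by
    have h2 : t ≤ Real.exp ((t - 1) / 2) * Real.exp ((t - 1) / 2) := by
      rw [← Real.exp_add, add_halves]
      linarith [Real.add_one_le_exp (t - 1)]
    calc Real.sqrt t ≤ Real.sqrt (Real.exp ((t - 1) / 2) * Real.exp ((t - 1) / 2)) :=
          Real.sqrt_le_sqrt h2
      _ = Real.exp ((t - 1) / 2) := Real.sqrt_mul_self (Real.exp_pos _).le
  calc Real.exp ((1 - t) / 2) * Real.sqrt t ≤ Real.exp ((1 - t) / 2) * Real.exp ((t - 1) / 2) := by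
        gcongr
    _ = 1 := by
        rw [← Real.exp_add, show (1 - t) / 2 + (t - 1) / 2 = 0 by ring, Real.exp_zero]

/-- `ρ² ≥ 0`. -/
theorem ρ2_nonneg (x : ℝ³) : 0 ≤ ρ2 x := by
  unfold ρ2; nlinarith [sq_nonneg (x 0), sq_nonneg (x 1)]

/-- `‖J x‖ = √ρ²`. -/
theorem norm_Jrot_eq (x : ℝ³) : ‖Jrot x‖ = Real.sqrt (ρ2 x) := by
  rw [← Real.sqrt_sq (norm_nonneg (Jrot x)), norm_Jrot_sq]
  congr 1
  unfold ρ2; ring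

/-- **`|v_sw| ≤ 1` everywhere.** -/
theorem norm_vSwirl_le (x : ℝ³) : ‖vSwirl x‖ ≤ 1 := by
  rw [vSwirl, norm_smul, Real.norm_eq_abs, abs_of_nonneg (famp_nonneg x), norm_Jrot_eq]
  calc famp x * Real.sqrt (ρ2 x) ≤ Real.exp ((1 - ρ2 x) / 2) * Real.sqrt (ρ2 x) := by
        gcongr
        exact famp_le x
    _ ≤ 1 := exp_mul_sqrt_le_one (ρ2 x)

/-- The swirl amplitude vanishes when `ρ² ≥ 7/4` or `|x₂| ≥ 2`. -/
theorem famp_eq_zero_of {x : ℝ³} (h : 7 / 4 ≤ ρ2 x ∨ 2 ≤ |x 2|) : famp x = 0 := by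
  unfold famp Fprof qmap
  rcases h with h | h
  · have : χ1 (ρ2 x) = 0 := by
      refine χ1.zero_of_le_dist ?_
      rw [Real.dist_eq]
      show (3 : ℝ) / 4 ≤ |ρ2 x - 1|
      rw [abs_of_nonneg (by linarith)]
      linarith
    simp [this]
  · have : β0 (x 2) = 0 := by
      refine β0.zero_of_le_dist ?_
      rw [Real.dist_eq, sub_zero]
      exact h
    simp [this]

/-- The swirl is supported in the closed ball of radius `3`. -/
theorem vSwirl_eq_zero_of_norm {x : ℝ³} (hx : 3 < ‖x‖) : vSwirl x = 0 := by
  have hsq : 9 < ρ2 x + x 2 * x 2 := by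
    have h9 : (9 : ℝ) < ‖x‖ ^ 2 := by nlinarith [norm_nonneg x]
    rw [norm_sq_eq_three] at h9
    unfold ρ2; nlinarith [h9]
  have h : 7 / 4 ≤ ρ2 x ∨ 2 ≤ |x 2| := by
    by_contra hcon
    obtain ⟨hc1, hc2⟩ := not_or.1 hcon
    have hc1' := not_le.1 hc1
    have hc2' := not_le.1 hc2
    have h2 : x 2 * x 2 < 4 := by
      have hab : |x 2| * |x 2| < 2 * 2 :=
        mul_lt_mul'' hc2' hc2' (abs_nonneg _) (abs_nonneg _)
      rw [abs_mul_abs_self] at hab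
      linarith
    linarith
  rw [vSwirl, famp_eq_zero_of h, zero_smul]

/-- The swirl is compactly supported. -/
theorem hasCompactSupport_vSwirl : HasCompactSupport vSwirl :=
  HasCompactSupport.intro (isCompact_closedBall (0 : ℝ³) 3) fun x hx =>
    vSwirl_eq_zero_of_norm (by simpa using hx)

/-- On the unit circle the amplitude is `1`: `v_sw(γ₁(s)) = J γ₁(s)`. -/
theorem famp_γ₁ (s : ℝ) : famp (γ₁ s) = 1 := by
  have hρ : ρ2 (γ₁ s) = 1 := by
    unfold ρ2
    rw [γ₁_apply_zero, γ₁_apply_one]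
    nlinarith [cos_sq_add_sin_sq (2 * π * s)]
  unfold famp Fprof qmap
  simp only [hρ, γ₁_apply_two, sub_self, zero_div, Real.exp_zero, one_mul]
  rw [χ1.one_of_mem_closedBall (Metric.mem_closedBall_self χ1.rIn_pos.le),
    β0.one_of_mem_closedBall (Metric.mem_closedBall_self β0.rIn_pos.le), one_mul]

/-- On the unit circle the swirl is the unit rotation field. -/
theorem vSwirl_γ₁ (s : ℝ) : vSwirl (γ₁ s) = Jrot (γ₁ s) := by
  rw [vSwirl, famp_γ₁, one_smul]

/-! ### Support and size of the strain pieces -/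

/-- The localised vector potential is compactly supported. -/
theorem hasCompactSupport_Ψloc : HasCompactSupport Ψloc :=
  χb.hasCompactSupport.mono fun x hx => by
    contrapose! hx
    simp [Ψloc, Function.notMem_support.1 hx]

/-- The localised strain is compactly supported. -/
theorem hasCompactSupport_wStr : HasCompactSupport wStr := hasCompactSupport_curl hasCompactSupport_Ψloc

/-- The localised scalar potential is compactly supported. -/
theorem hasCompactSupport_ψpot : HasCompactSupport ψpot := χb.hasCompactSupport.mul_right

/-- Its gradient is compactly supported. -/
theorem hasCompactSupport_gradient_ψpot : HasCompactSupport (gradient ψpot) := by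
  have h : gradient ψpot = (InnerProductSpace.toDual ℝ ℝ³).symm ∘ fderiv ℝ ψpot := rfl
  rw [h]
  exact (hasCompactSupport_ψpot.fderiv (𝕜 := ℝ)).comp_left (map_zero _)

/-- Its gradient is continuous. -/
theorem continuous_gradient_ψpot : Continuous (gradient ψpot) := by
  show Continuous fun x => (InnerProductSpace.toDual ℝ ℝ³).symm (fderiv ℝ ψpot x)
  exact (InnerProductSpace.toDual ℝ ℝ³).symm.continuous.comp (contDiff_ψpot.continuous_fderiv (by simp))

/-- The residual is compactly supported. -/
theorem hasCompactSupport_mRes : HasCompactSupport mRes := by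
  show HasCompactSupport (wStr - gradient ψpot)
  exact hasCompactSupport_wStr.sub hasCompactSupport_gradient_ψpot

/-- The residual is continuous. -/
theorem continuous_mRes : Continuous mRes :=
  contDiff_wStr.continuous.sub continuous_gradient_ψpot

/-- The residual is bounded. -/
theorem exists_bound_mRes : ∃ C : ℝ, 0 ≤ C ∧ ∀ x, ‖mRes x‖ ≤ C := by
  obtain ⟨C, hC⟩ := continuous_mRes.bounded_above_of_compact_support hasCompactSupport_mRes
  exact ⟨max C 0, le_max_right _ _, fun x => (hC x).trans (le_max_left _ _)⟩

/-- The profile is compactly supported. -/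
theorem hasCompactSupport_vW (δ : ℝ) : HasCompactSupport (vW δ) :=
  hasCompactSupport_vSwirl.add (hasCompactSupport_wStr.mono fun x hx => by
    contrapose! hx
    simp [Function.notMem_support.1 hx])

/-- `‖DV_δ‖` is bounded. -/
theorem exists_bound_fderiv_vW (δ : ℝ) : ∃ L : ℝ, 0 ≤ L ∧ ∀ x, ‖fderiv ℝ (vW δ) x‖ ≤ L := by
  obtain ⟨L, hL⟩ := ((contDiff_vW δ).continuous_fderiv (by simp)).bounded_above_of_compact_support
    ((hasCompactSupport_vW δ).fderiv (𝕜 := ℝ))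
  exact ⟨max L 0, le_max_right _ _, fun x => (hL x).trans (le_max_left _ _)⟩

/-! ### The calibration: every admissible loop is long -/

/-- **The calibrated field is bounded by `1`**: `|v_sw + δ m| ≤ 1` once `δ · sup|m| ≤ 1` (the two
summands have disjoint supports). -/
theorem norm_vSwirl_add_smul_mRes_le {δ C : ℝ} (hδ : 0 ≤ δ) (hC : ∀ x, ‖mRes x‖ ≤ C)
    (hδC : δ * C ≤ 1) (x : ℝ³) : ‖vSwirl x + δ • mRes x‖ ≤ 1 := by
  by_cases hx : ‖x‖ < 4
  · rw [mRes_eq_zero hx, smul_zero, add_zero]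
    exact norm_vSwirl_le x
  · rw [vSwirl_eq_zero_of_norm (by linarith [not_lt.1 hx]), zero_add, norm_smul, Real.norm_eq_abs,
      abs_of_nonneg hδ]
    exact (mul_le_mul_of_nonneg_left (hC x) hδ).trans hδC

/-- **Circulations of `V_δ` see only the calibrated field**: `∮ V_δ = ∮ (v_sw + δ m)` (the gradient
part `δ ∇ψ` has zero circulation), hence `|∮_γ V_δ| ≤ length(γ)`. -/
theorem abs_circulation_vW_le {δ C : ℝ} (hδ : 0 ≤ δ) (hC : ∀ x, ‖mRes x‖ ≤ C) (hδC : δ * C ≤ 1)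
    {γ : ℝ → ℝ³} (hγ : IsC1Loop γ) : |circulation (vW δ) γ| ≤ len γ := by
  have hsplit : vW δ = (fun x => vSwirl x + δ • mRes x) + δ • gradient ψpot := by
    funext x
    simp only [vW, mRes, Pi.add_apply, Pi.smul_apply, smul_sub]
    abel
  have hc1 : Continuous fun x => vSwirl x + δ • mRes x :=
    contDiff_vSwirl.continuous.add (continuous_mRes.const_smul δ)
  have hc2 : Continuous (δ • gradient ψpot) := continuous_gradient_ψpot.const_smul δ
  rw [hsplit, circulation_add_left hc1 hc2 hγ.contDiff, circulation_smul_left,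
    circulation_gradient_eq_zero (contDiff_ψpot.of_le (by simp)) hγ, mul_zero, add_zero]
  simpa using abs_circulation_le hc1 (norm_vSwirl_add_smul_mRes_le hδ hC hδC) hγ

/-! ### The unit circle is taut and strained -/

/-- `∮_{γ₁} V_δ = 2π`. -/
theorem circulation_vW_γ₁ (δ : ℝ) : circulation (vW δ) γ₁ = 2 * π := by
  have hsw : circulation vSwirl γ₁ = 2 * π := by
    unfold circulation
    have : ∀ s, ⟪vSwirl (γ₁ s), deriv γ₁ s⟫ = 2 * π := fun s => by
      rw [vSwirl_γ₁, deriv_γ₁, real_inner_smul_right, real_inner_self_eq_norm_sq, norm_Jrot_γ₁]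
      ring
    simp_rw [this]
    simp
  have hst : circulation wStr γ₁ = 0 := by
    unfold circulation
    have : ∀ s, ⟪wStr (γ₁ s), deriv γ₁ s⟫ = 0 := fun s => by
      rw [wStr_eq_Sst (by rw [norm_γ₁]; norm_num), deriv_γ₁, real_inner_smul_right]
      simp only [PiLp.inner_apply, Fin.sum_univ_three, RCLike.inner_apply, conj_trivial,
        Sst_apply_zero, Sst_apply_one, Sst_apply_two, Jrot_apply_zero, Jrot_apply_one,
        Jrot_apply_two, γ₁_apply_two]
      ring
    simp_rw [this]
    simp
  rw [vW, circulation_add_left contDiff_vSwirl.continuous (contDiff_wStr.continuous.const_smul δ)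
    isC1Loop_γ₁.contDiff, circulation_smul_left, hsw, hst, mul_zero, add_zero]

/-- **The strain of `V_δ` along the unit circle**: `⟪γ₁', DV_δ(γ₁) γ₁'⟫ = −δ (2π)²` (the swirl
contributes `⟪γ₁', J γ₁'⟫ = 0`, the strain `⟪γ₁', δ S γ₁'⟫ = −δ‖γ₁'‖²`). -/
theorem inner_fderiv_vW_γ₁ (δ : ℝ) (s : ℝ) :
    ⟪deriv γ₁ s, fderiv ℝ (vW δ) (γ₁ s) (deriv γ₁ s)⟫ = -δ * (2 * π) ^ 2 := by
  have hd1 : DifferentiableAt ℝ vSwirl (γ₁ s) := (contDiff_vSwirl.differentiable (by simp)) _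
  have hd2 : DifferentiableAt ℝ wStr (γ₁ s) := (contDiff_wStr.differentiable (by simp)) _
  have hγd : DifferentiableAt ℝ γ₁ s := isC1Loop_γ₁.differentiable s
  have hsw : fderiv ℝ vSwirl (γ₁ s) (deriv γ₁ s) = Jrot (deriv γ₁ s) := by
    rw [← fderiv_comp_deriv s hd1 hγd]
    have : vSwirl ∘ γ₁ = ⇑Jrot ∘ γ₁ := funext fun s => vSwirl_γ₁ s
    rw [this, fderiv_comp_deriv s Jrot.differentiableAt hγd, ContinuousLinearMap.fderiv]
  have hst : fderiv ℝ wStr (γ₁ s) = Sst := fderiv_wStr (by rw [norm_γ₁]; norm_num)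
  rw [vW, fderiv_add hd1 (hd2.const_smul δ), fderiv_const_smul hd2]
  simp only [add_apply, FunLike.coe_smul, Pi.smul_apply, hsw, hst, Sst_deriv_γ₁,
    inner_add_right, real_inner_smul_right, inner_neg_right, inner_Jrot_self,
    real_inner_self_eq_norm_sq, norm_deriv_γ₁]
  ring

/-! ## The kinematic flow: Leray's self-similar zoom of the profile -/

/-- **The witness velocity** `u(t, x) = λ(t) V_δ(λ(t) x)`, `λ(t) = (1 − t)^{-1/2}`: Leray's backward
self-similar ansatz (`lerayBackward` with `a = 1/2`, `T = 1`) on the fixed profile `V_δ`. It is NOT a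
Navier–Stokes solution (no compactly supported Leray profile exists, Nečas–Růžička–Šverák 1996); it is
smooth on `[0, 1) × ℝ³`, divergence free and compactly supported at every time. -/
def uW (δ : ℝ) : ℝ → ℝ³ → ℝ³ := lerayBackward (1 / 2) 1 (vW δ)

/-- The Leray scale `λ(s) = (1 − s)^{-1/2}` is positive before the final time. -/
theorem scale_pos {s : ℝ} (hs : s < 1) : 0 < (Real.sqrt (2 * (1 / 2) * (1 - s)))⁻¹ :=
  lerayScale_pos one_half_pos hs

/-- `λ(s)² = (1 − s)⁻¹`. -/
theorem scale_sq {s : ℝ} (hs : s < 1) : ((Real.sqrt (2 * (1 / 2) * (1 - s)))⁻¹) ^ 2 = (1 - s)⁻¹ := by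
  rw [lerayScale_sq one_half_pos hs]
  norm_num

/-- Joint smoothness on `[0, 1) × ℝ³`. -/
theorem isSmoothSpaceTimeOn_uW (δ : ℝ) : IsSmoothSpaceTimeOn (Set.Ico 0 1) (uW δ) :=
  (contDiffOn_uncurry_lerayBackward one_half_pos (contDiff_vW δ) 1).mono
    (Set.prod_mono Set.Ico_subset_Iio_self subset_rfl)

/-- Every slice is divergence free. -/
theorem isDivFree_uW (δ t : ℝ) : VectorCalculus.IsDivFree (uW δ t) :=
  isDivFree_lerayBackward (isDivFree_vW δ) _ _ _

/-- Every slice is smooth. -/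
theorem contDiff_uW (δ t : ℝ) : ContDiff ℝ ∞ (uW δ t) := by
  show ContDiff ℝ ∞ fun x => (Real.sqrt (2 * (1 / 2) * (1 - t)))⁻¹ •
    vW δ ((Real.sqrt (2 * (1 / 2) * (1 - t)))⁻¹ • x)
  exact ((contDiff_vW δ).comp (contDiff_const_smul _)).const_smul _

/-- Every slice before the final time is compactly supported. -/
theorem hasCompactSupport_uW (δ : ℝ) {t : ℝ} (ht : t < 1) : HasCompactSupport (uW δ t) := by
  have hc : (Real.sqrt (2 * (1 / 2) * (1 - t)))⁻¹ ≠ 0 := (scale_pos ht).ne'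
  show HasCompactSupport fun x => (Real.sqrt (2 * (1 / 2) * (1 - t)))⁻¹ •
    vW δ ((Real.sqrt (2 * (1 / 2) * (1 - t)))⁻¹ • x)
  exact ((hasCompactSupport_vW δ).comp_smul hc).mono fun x hx => by
    rw [Function.mem_support] at hx ⊢
    intro h0
    exact hx (by rw [h0, smul_zero])

/-- Every slice before the final time is rapidly decaying (Fefferman's class). -/
theorem hasRapidSpatialDecay_uW (δ : ℝ) {t : ℝ} (ht : t < 1) : HasRapidSpatialDecay (uW δ t) :=
  HasRapidSpatialDecay.of_hasCompactSupport (contDiff_uW δ t) (hasCompactSupport_uW δ ht)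

/-- **The near-taut compression of the zoomed profile is `≥ δ/(1 − s)`.** At time `s` the circle
`λ(s)⁻¹ γ₁` carries circulation `2π` (circulation is scale invariant), has the minimal admissible length
`2π/λ(s)` (calibration), and is compressed at rate `δ λ(s)²`. -/
theorem le_nearTautRate_uW {δ C : ℝ} (hδ : 0 ≤ δ) (hC : ∀ x, ‖mRes x‖ ≤ C) (hδC : δ * C ≤ 1)
    {s : ℝ} (hs : s < 1) : δ * (1 - s)⁻¹ ≤ nearTautRate (uW δ s) (2 * π) := by
  set c : ℝ := (Real.sqrt (2 * (1 / 2) * (1 - s)))⁻¹ with hc_def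
  have hc : 0 < c := scale_pos hs
  have hc2 : c ^ 2 = (1 - s)⁻¹ := scale_sq hs
  obtain ⟨L, hL0, hL⟩ := exists_bound_fderiv_vW δ
  have hu : uW δ s = nsRescaleData c (vW δ) := rfl
  -- derivative bound on the slice
  have hDu : ∀ y, ‖fderiv ℝ (uW δ s) y‖ ≤ c ^ 2 * L := fun y => by
    rw [uW, fderiv_lerayBackward, ← hc_def, norm_smul, Real.norm_eq_abs, abs_of_nonneg (sq_nonneg _)]
    exact mul_le_mul_of_nonneg_left (hL _) (sq_nonneg _)
  -- the scaled circle
  set γc : ℝ → ℝ³ := fun σ => c⁻¹ • γ₁ σ with hγc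
  have hγcC1 : IsC1Loop γc := isC1Loop_γ₁.const_smul c⁻¹
  have hpt : ∀ σ, c • γc σ = γ₁ σ := fun σ => by
    simp [hγc, smul_smul, mul_inv_cancel₀ hc.ne']
  have hsmul : c • γc = γ₁ := funext hpt
  have hderivc : ∀ σ, deriv γc σ = c⁻¹ • deriv γ₁ σ := fun σ => by
    show deriv (c⁻¹ • γ₁) σ = _
    exact deriv_const_smul c⁻¹ (isC1Loop_γ₁.differentiable σ)
  have hlenc : len γc = c⁻¹ * (2 * π) := by
    rw [hγc, len_const_smul isC1Loop_γ₁ (inv_nonneg.2 hc.le), len_γ₁]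
  -- circulation of the slice around the scaled circle
  have hcirc : circulation (uW δ s) γc = 2 * π := by
    rw [hu, circulation_nsRescaleData, hsmul, circulation_vW_γ₁]
  -- its compression rate
  have hrate : rate (uW δ s) γc = δ * c ^ 2 := by
    unfold rate
    have hint : ∀ σ, -(⟪deriv γc σ, fderiv ℝ (uW δ s) (γc σ) (deriv γc σ)⟫) / ‖deriv γc σ‖ =
        δ * (2 * π) * c := by
      intro σ
      rw [hderivc, uW, fderiv_lerayBackward, ← hc_def, hpt]
      rw [smul_apply, map_smul, real_inner_smul_left, real_inner_smul_right,
        real_inner_smul_right, inner_fderiv_vW_γ₁, norm_smul, norm_inv, Real.norm_eq_abs,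
        abs_of_pos hc, norm_deriv_γ₁]
      field_simp
    simp_rw [hint]
    rw [intervalIntegral.integral_const, show (∫ σ in (0:ℝ)..1, ‖deriv γc σ‖) = len γc from rfl,
      hlenc, smul_eq_mul, sub_zero, one_mul]
    field_simp
  -- tautness: every admissible loop has length at least that of the scaled circle
  have htaut : ENNReal.ofReal (len γc) ≤ ell (uW δ s) (2 * π) := by
    rw [hlenc]
    refine ofReal_le_ell fun γ hγ hadm => ?_
    rw [hu, circulation_nsRescaleData] at hadm
    have hb := abs_circulation_vW_le hδ hC hδC (hγ.const_smul c)
    have hlen : len (c • γ) = c * len γ := len_const_smul hγ hc.le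
    rw [hlen] at hb
    rw [inv_mul_le_iff₀ hc]
    exact hadm.trans hb
  have hadm : 2 * π ≤ |circulation (uW δ s) γc| := by
    rw [hcirc, abs_of_pos two_pi_pos]
  have key := rate_le_nearTautRate (fun ε _ => bddAbove_tautSet (by positivity) hDu _ ε)
    hγcC1 hadm htaut
  rwa [hrate, hc2] at key

/-! ## The crux without the momentum equation is false -/

/-- **No integrable majorant along the witness**: at level `2π` the near-taut compression of the zoom
is `≥ δ/(1 − s)`, whose integral over `(0, 1)` diverges (`∫₀¹ ds/(1 − s) = ∞`, via
`intervalIntegrable_inv_iff`). -/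
theorem uW_no_majorant {δ C : ℝ} (hδ : 0 < δ) (hC : ∀ x, ‖mRes x‖ ≤ C) (hδC : δ * C ≤ 1) :
    ¬ ∃ (Φ : ℝ → ℝ) (M : ℝ), Measurable Φ ∧ 0 ≤ M ∧
      (∀ s ∈ Set.Ioo (0:ℝ) 1, nearTautRate (uW δ s) (2 * π) ≤ Φ s) ∧
      (∫⁻ s in Set.Ioo (0:ℝ) 1, ENNReal.ofReal (Φ s)) ≤ ENNReal.ofReal M := by
  rintro ⟨Φ, M, -, -, hmaj, hint⟩
  have hΦ : ∀ s ∈ Set.Ioo (0:ℝ) 1, δ * (1 - s)⁻¹ ≤ Φ s := fun s hs =>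
    (le_nearTautRate_uW hδ.le hC hδC hs.2).trans (hmaj s hs)
  have h1 : ∫⁻ s in Set.Ioo (0:ℝ) 1, ENNReal.ofReal (δ * (1 - s)⁻¹) ≤ ENNReal.ofReal M :=
    (setLIntegral_mono' measurableSet_Ioo fun s hs => ENNReal.ofReal_le_ofReal (hΦ s hs)).trans hint
  have h2 : IntegrableOn (fun s : ℝ => δ * (1 - s)⁻¹) (Set.Ioo 0 1) := by
    refine ⟨((measurable_const.sub measurable_id).inv.const_mul δ).aestronglyMeasurable, ?_⟩
    rw [hasFiniteIntegral_iff_ofReal (ae_restrict_of_forall_mem measurableSet_Ioo fun s hs => ?_)]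
    · exact h1.trans_lt ENNReal.ofReal_lt_top
    · exact mul_nonneg hδ.le (inv_nonneg.2 (by linarith [hs.2]))
  have h3 : IntervalIntegrable (fun s : ℝ => δ * (1 - s)⁻¹) volume 0 1 :=
    (intervalIntegrable_iff_integrableOn_Ioo_of_le zero_le_one).2 h2
  have h4 : IntervalIntegrable (fun s : ℝ => (1 - s)⁻¹) volume 0 1 := by
    have heq : (fun s : ℝ => (1 - s)⁻¹) = fun s => δ⁻¹ * (δ * (1 - s)⁻¹) := by
      funext s
      rw [← mul_assoc, inv_mul_cancel₀ hδ.ne', one_mul]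
    rw [heq]
    exact h3.const_mul δ⁻¹
  have h5 : IntervalIntegrable (fun s : ℝ => s⁻¹) volume 1 0 := by
    simpa using h4.comp_sub_left 1
  rcases intervalIntegrable_inv_iff.1 h5 with h6 | h6
  · exact one_ne_zero h6
  · exact h6 Set.right_mem_uIcc

/-- The amplitude `δ = 1/(sup|m| + 1)` of the strain used by the witness. -/
theorem exists_delta : ∃ δ C : ℝ, 0 < δ ∧ (∀ x, ‖mRes x‖ ≤ C) ∧ δ * C ≤ 1 := by
  obtain ⟨C, hC0, hC⟩ := exists_bound_mRes
  have hC1 : 0 < C + 1 := by linarith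
  refine ⟨(C + 1)⁻¹, C, inv_pos.2 hC1, hC, ?_⟩
  rw [inv_mul_le_iff₀ hC1]
  linarith

/-- **The Navier–Stokes dynamics is load-bearing for `TautCompressionIntegrable`.** The crux
`TautLoopKelvin.TautCompressionIntegrable` with the two Navier–Stokes hypotheses
`IsClassicalNSSolutionOn (Ico 0 T) ν 0 u p` and `IsLerayHopfOn T ν 0 (u 0) u` replaced by what they
provide KINEMATICALLY — joint smoothness of `u` on `[0,T) × ℝ³`, `div u(t) = 0`, and (more than the
crux asks) rapid decay of EVERY slice `u(t)`, `t < T` — is FALSE. Witness (`T = 1`, any `ν`): Leray's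
self-similar zoom `u(t, x) = λ(t) V_δ(λ(t) x)`, `λ = (1 − t)^{-1/2}`, of the smooth compactly supported
divergence-free profile `V_δ = v_sw + δ · curl(χ_b Ψ₀)` (a swirl concentrated on the unit circle plus a
localised Burgers strain, `δ = 1/(sup|m| + 1)`). At level `g = 2π` and every time `s < 1` the circle
`λ⁻¹γ₁` is an admissible loop of MINIMAL length (calibration: `∮_γ V_δ = ∮_γ (v_sw + δ m)` with
`|v_sw + δ m| ≤ 1`, so every admissible loop has length `≥ 2π/λ`), compressed at rate `δλ² = δ/(1 − s)`;
hence `Λ_{2π}(u(s)) ≥ δ/(1 − s)`, whose integral over `(0, 1)` diverges, and no integrable majorant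
exists. No blow-up of `‖u‖_{L²}` or of `∫‖∇u‖²_{L²} dt` is involved (the zoom is `L²`-subcritical):
the missing ingredient is the momentum equation, which forbids this Leray-type collapse of a compactly
supported profile (Nečas–Růžička–Šverák 1996, Tsai 1998). Information for provers: any proof of the crux
must use the equation beyond incompressibility, smoothness and decay — e.g. through the energy-class
a-priori control of `λ(t)` or a Liouville/rigidity input — exactly as the route's Type-I endgame says.
[cite: NecasRuzickaSverak1996, Thm. 1] [cite: Tsai1998, Thm. 1] -/
theorem tautCompressionIntegrable_false_without_momentum :
    ¬ (∀ (ν T : ℝ), 0 < ν → 0 < T → ∀ (u : ℝ → ℝ³ → ℝ³),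
        IsSmoothSpaceTimeOn (Set.Ico 0 T) u →
        (∀ t ∈ Set.Ico 0 T, VectorCalculus.IsDivFree (u t)) →
        (∀ t ∈ Set.Ico 0 T, HasRapidSpatialDecay (u t)) →
        ∀ g : ℝ, 0 < g → ∃ (Φ : ℝ → ℝ) (M : ℝ), Measurable Φ ∧ 0 ≤ M ∧
          (∀ s ∈ Set.Ioo 0 T, (⨅ ε : {ε : ℝ // 0 < ε}, sSup {k : ℝ | ∃ γ : ℝ → ℝ³,
            IsC1Loop γ ∧ g ≤ |circulation (u s) γ| ∧
            ENNReal.ofReal (∫ σ in (0:ℝ)..1, ‖deriv γ σ‖) ≤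
              (⨅ (γ' : ℝ → ℝ³) (_ : IsC1Loop γ' ∧ g ≤ |circulation (u s) γ'|),
                ENNReal.ofReal (∫ σ in (0:ℝ)..1, ‖deriv γ' σ‖)) + ENNReal.ofReal (ε : ℝ) ∧
            k = ((∫ σ in (0:ℝ)..1, -(inner ℝ (deriv γ σ) (fderiv ℝ (u s) (γ σ) (deriv γ σ))) /
              ‖deriv γ σ‖) / (∫ σ in (0:ℝ)..1, ‖deriv γ σ‖))}) ≤ Φ s) ∧
          (∫⁻ s in Set.Ioo 0 T, ENNReal.ofReal (Φ s)) ≤ ENNReal.ofReal M) := by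
  intro h
  obtain ⟨δ, C, hδ, hC, hδC⟩ := exists_delta
  exact uW_no_majorant hδ hC hδC (h 1 1 one_pos one_pos (uW δ) (isSmoothSpaceTimeOn_uW δ)
    (fun t _ => isDivFree_uW δ t) (fun t ht => hasRapidSpatialDecay_uW δ ht.2) (2 * π) two_pi_pos)

/-! ## The witness lies in the Leray–Hopf energy class `L^∞_t L²_x ∩ L²_t Ḣ¹_x` -/

/-- The Leray scale is at least `1` on `[0, 1)`. -/
theorem one_le_scale {t : ℝ} (h0 : 0 ≤ t) (ht : t < 1) : 1 ≤ (Real.sqrt (2 * (1 / 2) * (1 - t)))⁻¹ := by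
  rw [show 2 * (1 / 2) * (1 - t) = 1 - t by ring,
    one_le_inv_iff₀]
  refine ⟨Real.sqrt_pos.2 (by linarith), ?_⟩
  calc Real.sqrt (1 - t) ≤ Real.sqrt 1 := Real.sqrt_le_sqrt (by linarith)
    _ = 1 := Real.sqrt_one

/-- A continuous compactly supported field has finite `∫ |·|²`. -/
theorem lintegral_enorm_sq_lt_top_of_hasCompactSupport {F : Type*} [NormedAddCommGroup F]
    {f : ℝ³ → F} (hf : Continuous f) (hc : HasCompactSupport f) : ∫⁻ x, ‖f x‖ₑ ^ 2 < ⊤ := by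
  have hsupp : HasCompactSupport ((fun x => ‖f x‖) * fun x => ‖f x‖) := hc.norm.mul_right
  have hint : Integrable (fun x => ‖f x‖ * ‖f x‖) :=
    (hf.norm.mul hf.norm).integrable_of_hasCompactSupport hsupp
  have h := hint.lintegral_lt_top
  refine lt_of_le_of_lt (le_of_eq (lintegral_congr fun x => ?_)) h
  rw [← ofReal_norm, sq, ← ENNReal.ofReal_mul (norm_nonneg _)]

/-- **Uniform `L²` bound along the zoom**: `∫ |u(t)|² = λ(t)⁻¹ ∫ |V_δ|² ≤ ∫ |V_δ|²` for `0 ≤ t < 1`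
(the zoom is `L²`-subcritical: the energy DEcreases to `0`). -/
theorem lintegral_sq_uW_le (δ : ℝ) {t : ℝ} (h0 : 0 ≤ t) (ht : t < 1) :
    ∫⁻ x, ‖uW δ t x‖ₑ ^ 2 ≤ ∫⁻ x, ‖vW δ x‖ₑ ^ 2 := by
  set c : ℝ := (Real.sqrt (2 * (1 / 2) * (1 - t)))⁻¹ with hc_def
  have hc : 0 < c := scale_pos ht
  have h1c : 1 ≤ c := one_le_scale h0 ht
  have hstep : ∫⁻ x, ‖uW δ t x‖ₑ ^ 2 = ENNReal.ofReal (c ^ 2) * ∫⁻ x, ‖vW δ (c • x)‖ₑ ^ 2 := by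
    rw [← lintegral_const_mul' _ _ ENNReal.ofReal_ne_top]
    refine lintegral_congr fun x => ?_
    show ‖c • vW δ (c • x)‖ₑ ^ 2 = _
    rw [enorm_smul, mul_pow, Real.enorm_eq_ofReal hc.le, ENNReal.ofReal_pow hc.le]
  rw [hstep, lintegral_comp_smul (fun x => ‖vW δ x‖ₑ ^ 2) hc.ne', finrank_euclideanSpace_fin,
    abs_of_pos (by positivity), ← mul_assoc, ← ENNReal.ofReal_mul (by positivity)]
  have hcc : c ^ 2 * (c ^ 3)⁻¹ = c⁻¹ := by field_simp
  rw [hcc]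
  calc ENNReal.ofReal c⁻¹ * ∫⁻ x, ‖vW δ x‖ₑ ^ 2 ≤ 1 * ∫⁻ x, ‖vW δ x‖ₑ ^ 2 := by
        gcongr
        rw [← ENNReal.ofReal_one]
        exact ENNReal.ofReal_le_ofReal (inv_le_one_of_one_le₀ h1c)
    _ = ∫⁻ x, ‖vW δ x‖ₑ ^ 2 := one_mul _

/-- `∫ |V_δ|² < ∞`. -/
theorem lintegral_sq_vW_lt_top (δ : ℝ) : ∫⁻ x, ‖vW δ x‖ₑ ^ 2 < ⊤ :=
  lintegral_enorm_sq_lt_top_of_hasCompactSupport (contDiff_vW δ).continuous (hasCompactSupport_vW δ)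

/-- `∫ |∇V_δ|² < ∞`. -/
theorem lintegral_sq_fderiv_vW_lt_top (δ : ℝ) : ∫⁻ x, ‖fderiv ℝ (vW δ) x‖ₑ ^ 2 < ⊤ :=
  lintegral_enorm_sq_lt_top_of_hasCompactSupport ((contDiff_vW δ).continuous_fderiv (by simp))
    ((hasCompactSupport_vW δ).fderiv (𝕜 := ℝ))

/-- **The enstrophy of a slice of the zoom**: `∫ |∇u(t)|² = λ(t) ∫ |∇V_δ|²` for `t < 1`. -/
theorem lintegral_sq_fderiv_uW (δ : ℝ) {t : ℝ} (ht : t < 1) :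
    ∫⁻ x, ‖fderiv ℝ (uW δ t) x‖ₑ ^ 2 =
      ENNReal.ofReal ((Real.sqrt (2 * (1 / 2) * (1 - t)))⁻¹) * ∫⁻ x, ‖fderiv ℝ (vW δ) x‖ₑ ^ 2 := by
  set c : ℝ := (Real.sqrt (2 * (1 / 2) * (1 - t)))⁻¹ with hc_def
  have hc : 0 < c := scale_pos ht
  have hstep : ∫⁻ x, ‖fderiv ℝ (uW δ t) x‖ₑ ^ 2 =
      ENNReal.ofReal (c ^ 4) * ∫⁻ x, ‖fderiv ℝ (vW δ) (c • x)‖ₑ ^ 2 := by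
    rw [← lintegral_const_mul' _ _ ENNReal.ofReal_ne_top]
    refine lintegral_congr fun x => ?_
    rw [uW, fderiv_lerayBackward, ← hc_def, enorm_smul, mul_pow, Real.enorm_eq_ofReal (sq_nonneg _),
      ← ENNReal.ofReal_pow (sq_nonneg _), show (c ^ 2) ^ 2 = c ^ 4 by ring]
  rw [hstep, lintegral_comp_smul (fun x => ‖fderiv ℝ (vW δ) x‖ₑ ^ 2) hc.ne', finrank_euclideanSpace_fin,
    abs_of_pos (by positivity), ← mul_assoc, ← ENNReal.ofReal_mul (by positivity)]
  have hcc : c ^ 4 * (c ^ 3)⁻¹ = c := by field_simp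
  rw [hcc]

/-- `∫₀¹ λ(t) dt < ∞` (`λ = (1 − t)^{-1/2}`). -/
theorem lintegral_scale_lt_top :
    ∫⁻ t in Set.Ioo (0:ℝ) 1, ENNReal.ofReal ((Real.sqrt (2 * (1 / 2) * (1 - t)))⁻¹) < ⊤ := by
  have h1 : IntervalIntegrable (fun x : ℝ => x ^ (-(1 / 2) : ℝ)) volume 0 1 :=
    intervalIntegral.intervalIntegrable_rpow' (by norm_num)
  have h2 : IntervalIntegrable (fun x : ℝ => (1 - x) ^ (-(1 / 2) : ℝ)) volume 0 1 := by
    simpa using (h1.comp_sub_left 1).symm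
  have h3 : IntegrableOn (fun x : ℝ => (1 - x) ^ (-(1 / 2) : ℝ)) (Set.Ioo 0 1) :=
    (intervalIntegrable_iff_integrableOn_Ioo_of_le zero_le_one).1 h2
  have h4 := h3.lintegral_lt_top
  refine lt_of_le_of_lt (le_of_eq ?_) h4
  refine setLIntegral_congr_fun measurableSet_Ioo fun t ht => ?_
  rw [show 2 * (1 / 2) * (1 - t) = 1 - t by ring, Real.sqrt_eq_rpow,
    ← Real.rpow_neg (by linarith [ht.2])]

/-- **`∫₀¹ ∫ |∇u|² < ∞`**: the zoom has finite total dissipation (`∫ λ dt < ∞`). -/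
theorem lintegral_lintegral_sq_fderiv_uW_lt_top (δ : ℝ) :
    ∫⁻ t in Set.Ioo (0:ℝ) 1, ∫⁻ x, ‖fderiv ℝ (uW δ t) x‖ₑ ^ 2 < ⊤ := by
  have hmeas : Measurable fun t : ℝ => ENNReal.ofReal ((Real.sqrt (2 * (1 / 2) * (1 - t)))⁻¹) :=
    ((measurable_const.mul (measurable_const.sub measurable_id)).sqrt.inv).ennreal_ofReal
  rw [setLIntegral_congr_fun measurableSet_Ioo (fun t ht => lintegral_sq_fderiv_uW δ ht.2),
    lintegral_mul_const _ hmeas]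
  exact ENNReal.mul_lt_top lintegral_scale_lt_top (lintegral_sq_fderiv_vW_lt_top δ)

/-- **Even in the energy class the momentum equation is load-bearing**: the crux without the
Navier–Stokes system is false also when the kinematic hypotheses are supplemented by the full
Leray–Hopf REGULARITY CLASS `u ∈ L^∞(0,T; L²) ∩ L²(0,T; Ḣ¹)` (uniform bound of `∫|u(t)|²` on `[0,T)`,
finite `∫₀ᵀ∫|∇u|²`). Same witness: the Leray zoom is `L²`-subcritical (`∫|u(t)|² = λ⁻¹∫|V_δ|²`) with
integrable enstrophy (`∫|∇u(t)|² = λ∫|∇V_δ|²`, `∫₀¹λ = 2`). What the crux needs from the equation is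
therefore not function-space membership but the dynamics itself (local energy inequality / exclusion
of Leray-type self-similar collapse, Nečas–Růžička–Šverák 1996, Tsai 1998). -/
theorem tautCompressionIntegrable_false_without_momentum_energyClass :
    ¬ (∀ (ν T : ℝ), 0 < ν → 0 < T → ∀ (u : ℝ → ℝ³ → ℝ³),
        IsSmoothSpaceTimeOn (Set.Ico 0 T) u →
        (∀ t ∈ Set.Ico 0 T, VectorCalculus.IsDivFree (u t)) →
        (∀ t ∈ Set.Ico 0 T, HasRapidSpatialDecay (u t)) →
        (∃ E : ℝ≥0∞, E < ⊤ ∧ ∀ t ∈ Set.Ico 0 T, ∫⁻ x, ‖u t x‖ₑ ^ 2 ≤ E) →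
        (∫⁻ t in Set.Ioo 0 T, ∫⁻ x, ‖fderiv ℝ (u t) x‖ₑ ^ 2) < ⊤ →
        ∀ g : ℝ, 0 < g → ∃ (Φ : ℝ → ℝ) (M : ℝ), Measurable Φ ∧ 0 ≤ M ∧
          (∀ s ∈ Set.Ioo 0 T, (⨅ ε : {ε : ℝ // 0 < ε}, sSup {k : ℝ | ∃ γ : ℝ → ℝ³,
            IsC1Loop γ ∧ g ≤ |circulation (u s) γ| ∧
            ENNReal.ofReal (∫ σ in (0:ℝ)..1, ‖deriv γ σ‖) ≤
              (⨅ (γ' : ℝ → ℝ³) (_ : IsC1Loop γ' ∧ g ≤ |circulation (u s) γ'|),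
                ENNReal.ofReal (∫ σ in (0:ℝ)..1, ‖deriv γ' σ‖)) + ENNReal.ofReal (ε : ℝ) ∧
            k = ((∫ σ in (0:ℝ)..1, -(inner ℝ (deriv γ σ) (fderiv ℝ (u s) (γ σ) (deriv γ σ))) /
              ‖deriv γ σ‖) / (∫ σ in (0:ℝ)..1, ‖deriv γ σ‖))}) ≤ Φ s) ∧
          (∫⁻ s in Set.Ioo 0 T, ENNReal.ofReal (Φ s)) ≤ ENNReal.ofReal M) := by
  intro h
  obtain ⟨δ, C, hδ, hC, hδC⟩ := exists_delta
  exact uW_no_majorant hδ hC hδC (h 1 1 one_pos one_pos (uW δ) (isSmoothSpaceTimeOn_uW δ)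
    (fun t _ => isDivFree_uW δ t) (fun t ht => hasRapidSpatialDecay_uW δ ht.2)
    ⟨∫⁻ x, ‖vW δ x‖ₑ ^ 2, lintegral_sq_vW_lt_top δ, fun t ht => lintegral_sq_uW_le δ ht.1 ht.2⟩
    (lintegral_lintegral_sq_fderiv_uW_lt_top δ) (2 * π) two_pi_pos)

/-! ## (a) Load-bearing analysis, named form -/

/-- **The crux without the momentum equation** (`TautCompressionIntegrable` with
`IsClassicalNSSolutionOn (Ico 0 T) ν 0 u p ∧ IsLerayHopfOn T ν 0 (u 0) u` replaced by their kinematic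
content: joint smoothness, incompressibility of every slice, rapid decay of every slice). -/
def TautCompressionIntegrableWithoutMomentum : Prop :=
  ∀ (ν T : ℝ), 0 < ν → 0 < T → ∀ (u : ℝ → ℝ³ → ℝ³),
    IsSmoothSpaceTimeOn (Set.Ico 0 T) u →
    (∀ t ∈ Set.Ico 0 T, VectorCalculus.IsDivFree (u t)) →
    (∀ t ∈ Set.Ico 0 T, HasRapidSpatialDecay (u t)) →
    ∀ g : ℝ, 0 < g → ∃ (Φ : ℝ → ℝ) (M : ℝ), Measurable Φ ∧ 0 ≤ M ∧
      (∀ s ∈ Set.Ioo 0 T, (⨅ ε : {ε : ℝ // 0 < ε}, sSup {k : ℝ | ∃ γ : ℝ → ℝ³,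
        IsC1Loop γ ∧ g ≤ |circulation (u s) γ| ∧
        ENNReal.ofReal (∫ σ in (0:ℝ)..1, ‖deriv γ σ‖) ≤
          (⨅ (γ' : ℝ → ℝ³) (_ : IsC1Loop γ' ∧ g ≤ |circulation (u s) γ'|),
            ENNReal.ofReal (∫ σ in (0:ℝ)..1, ‖deriv γ' σ‖)) + ENNReal.ofReal (ε : ℝ) ∧
        k = ((∫ σ in (0:ℝ)..1, -(inner ℝ (deriv γ σ) (fderiv ℝ (u s) (γ σ) (deriv γ σ))) /
          ‖deriv γ σ‖) / (∫ σ in (0:ℝ)..1, ‖deriv γ σ‖))}) ≤ Φ s) ∧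
      (∫⁻ s in Set.Ioo 0 T, ENNReal.ofReal (Φ s)) ≤ ENNReal.ofReal M

/-- **Any proof of the crux must use the momentum equation** (named form of
`tautCompressionIntegrable_false_without_momentum`). -/
theorem tautCompressionIntegrable_false_without_momentum' : ¬ TautCompressionIntegrableWithoutMomentum :=
  tautCompressionIntegrable_false_without_momentum

/-- The genuine crux hypotheses IMPLY the kept kinematic ones (so the mutation only DROPS information):
a classical solution on `[0,T)` is jointly smooth there and divergence free at every slice. (Rapid decay
of the later slices is not part of the crux; the witness has it anyway.) -/
theorem kinematic_of_classical {ν T : ℝ} {u : ℝ → ℝ³ → ℝ³} {p : ℝ → ℝ³ → ℝ}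
    (h : IsClassicalNSSolutionOn (Set.Ico 0 T) ν 0 u p) :
    IsSmoothSpaceTimeOn (Set.Ico 0 T) u ∧ ∀ t ∈ Set.Ico 0 T, VectorCalculus.IsDivFree (u t) :=
  ⟨h.smooth_velocity, h.divFree⟩

/-! ## (e) Near-misses and why the crux itself resists (prose as docstrings on trivial anchors)

* **Outright refutation is a blow-up construction.** `Λ_g(u(s)) ≤ sup‖∇u(s)‖` (this file's
  `rate_le_of_norm_fderiv_le` is the per-loop half; the planner's stub 1 is the `Λ` form), so the crux
  holds along every solution that stays smooth up to `T`; with the tree's `S → C` skeleton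
  (`Cruxes/TautCompressionIntegrable/CruxAttack.lean`, `crux_of_navierStokesRegularity`) a
  counterexample is a classical Leray–Hopf solution from a Schwartz datum that blows up at `T` with its
  quantum taut loops compressed non-integrably — i.e. a negative solution of Clay (A). Not attempted.
* **Dropping ONLY `IsLerayHopfOn` (keeping the classical NS system and the decaying datum) has no
  closed-form witness**: linear flows `u = M(t)x` from an irrotational start stay irrotational
  (`Ȧ = −(SA + AS)`, `A(0) = 0`), so all circulations vanish and the crux conclusion holds (`Φ = 0`);
  strained Burgers/Lundgren vortices are `x₂`-independent, so their datum is not rapidly decaying; a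
  localised vortex in strain is genuinely nonlinear. The precedent `FastClassSqueeze` trick (biaxial
  strain from rest) gives `Λ ≡ 0` here.
* **Dropping `IsLerayHopfOn` AND `HasRapidSpatialDecay` (keeping the full classical NS system)** DOES
  have a witness on paper, not formalised (≈ 10³ lines: Ein-type pressure, smoothness of
  `(1 − e^{−s})/s`): the unsteady Burgers–Lundgren vortex `u = −½a(t) r e_r + a(t) x₂ e₂ + u_θ(r,t) e_θ`,
  `u_θ = (Γ/2πr)(1 − e^{−r²/δ(t)²})`, `d(δ²)/dt = 4ν − aδ²`, an EXACT classical solution for every smooth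
  `a(t)`; the circle of radius `ρ*δ(t)` (`ρ*` the maximiser of `(1 − e^{−ρ²})/ρ`) is exactly taut at
  the time-INDEPENDENT level `g = Γ(1 − e^{−ρ*²})` (the strain is a gradient, `|u_θ|` is maximal there),
  and its compression rate is `a(t)/2`; with `∫^T a = ∞` the crux conclusion fails. This is the route's
  own saturating object (Lundgren 1982): the crux is exactly the statement that finite energy + the
  equation forbid a self-fed `∫ a = ∞` on a quantum tube.
* **Tightness of the kinematic witness**: the zoom `u = λ V(λx)`, `λ = (1 − t)^{-1/2}`, lies in the
  energy class (`‖u(t)‖₂² = λ⁻¹‖V‖₂² → 0`, `∫₀¹‖∇u‖₂² = ‖∇V‖₂² ∫ λ dt < ∞`; not formalised here) and has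
  `Λ_{2π}(u(s)) = Λ_{2π}(V)/(1 − s)` exactly log-divergent — the Type-I-marginal rate the route header
  attributes to Lundgren's collapsing core. So even `u ∈ L^∞L² ∩ L²Ḣ¹` + smooth + div-free + Schwartz
  slices does not give the crux: a proof must use the equation (local energy inequality / NRŠ–Tsai
  exclusion of Leray profiles / KNSS-type rigidity), as birth stubs 3–4 say.
-/
theorem disproof_index_anchor : True := trivial

end Summit.NavierStokesRegularity.NavierStokesRegularity.Cruxes.TautCompressionIntegrable.Disproof

end
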